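import Summits.ResolutionOfSingularities.ResolutionOfSingularities.Theorems.FrobeniusLadderFRationalResolutionConeChain
import Summits.ResolutionOfSingularities.ResolutionOfSingularities.Theorems.FrobeniusLadderFRationalResolutionVertexChartBlowupCharts
import Summits.ResolutionOfSingularities.ResolutionOfSingularities.Theorems.FrobeniusLadderFRationalResolutionVertexChartRegularity
import Summits.ResolutionOfSingularities.ResolutionOfSingularities.Theorems.FrobeniusLadderFRationalResolutionVertexChartSmallParameter
import HarnessLib

/-!
# Crux `FrobeniusLadder.FRationalResolution` (stmt-ResolutionOfSingularities-15317), line `redirect`,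
# stub `stub_diagonalizableQuotientResolution` — **one round of the point-blow-up recursion at the ring
# level for a CONE chart algebra** (surface case over arbitrary fields; puts brick C1 `…ConeChain` into the
# tree's `LogChart.blowupChartMonoid` / `blowupAlgebra` currency and feeds `…VertexChartRegularity`,
# `…VertexChartSmallParameter`, `…ChartAlgebraFixedPointDim`; generalises `…VertexChartBlowupStep` from
# vertex charts (three generators) to cones in normal form (the whole Hirzebruch–Jung chain) — in
# particular it covers the FIRST round, the base chart being a chart algebra over itself, `…BaseChartAlgebra`)

DATA: a chart `φ : P → A` log regular at `𝔭`, `L = ℤF_𝔭`, and a chart algebra `(C, Q, χ)` over it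
(`…ChartAlgebraNormalForm`: (χ), (gen), (D), (K), (Ω)) whose monoid is a **cone in normal form**
`Q = L + {m u + l e : l ≥ 0, a l ≤ d m}`, `0 ≤ a < d`, `(u, e)` independent modulo `L` and spanning.

* `blowupChartMonoid_eq_closure` — the tree's chart monoid at `h` along `S = {q : Q | q ∈ s}` is
  `⟨Q ∪ (s − h)⟩`; `cone_face` — (S) for cones; `span_chi_eq_of_generates` — a set generating `Q ∖ L`
  over `Q` generates the ideal `(χ(Q ∖ L))`; `cone_of_vertex` — a vertex chart with parameter `c ≥ 1` is
  a cone in normal form with `(d, a) = (c, c − 1)` (so the output of a round is again an input);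
* **`round_charts`** — the Hirzebruch–Jung chain `s ⊆ Q ∖ L` (finite, generating `Q ∖ L` over `Q`) such
  that EVERY chart monoid `LogChart.blowupChartMonoid Q S h`, `h ∈ s`, is a vertex chart monoid with
  parameter `c ≤ 1 ∨ c + 2 ≤ d`;
* **`maximalIdeal_fixedPrime_eq_map_span`** — at the fixed prime `𝔓` (over a point `𝔭` of zero-dimensional
  stratum) `𝔪_{C_𝔓} = (χ(s))·C_𝔓`: the point blow-up of the fixed point IS the log blow-up along `s`,
  covered by the charts `C[(χ(s))/χ(h)]`, `h ∈ s`;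
* **`isRegularLocalRing_chart_of_not_mem`**, **`isRegularLocalRing_chart_of_param_le_one`**,
  **`not_isRegularLocalRing_chart_fixedPrime`** — on the chart at `h` with vertex data `(v, x, c)`: a prime
  over `𝔭` where one of `χ_h(v), χ_h(x), χ_h(y)` is a unit is regular; for `c ≤ 1` every prime over `𝔭`
  is regular; for `c ≥ 2` (over a surface point of zero-dimensional stratum) the fixed prime is singular.

So over a rank-two point every singular point of the blow-up is the fixed point of a vertex chart with
`2 ≤ c ≤ d − 2`, itself a cone with `d' = c`: the measure `d` drops by `2` per round. Honest label:
assembly toward ONE leaf stub (no stub, crux or summit closed). No definitions, no named facts, no sorry.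
[cite: Kato1994, (6.1), (10.1), (10.3)] [cite: Niziol2006, §4] [cite: KempfEtAl1973, Ch. I §2]
-/

noncomputable section

-- single-problem summit: the doubled namespace component is forced
set_option linter.dupNamespace false

open IsLocalRing Literature.AlgebraicGeometry.Resolution Literature.AlgebraicGeometry.Resolution.LogChart
open Summit.ResolutionOfSingularities.ResolutionOfSingularities.Theorems.FRationalResolution.ChartAlgebraFixedPoint
open Summit.ResolutionOfSingularities.ResolutionOfSingularities.Theorems.FRationalResolution.ChartAlgebraFixedPointDim
open Summit.ResolutionOfSingularities.ResolutionOfSingularities.Theorems.FRationalResolution.ChartAlgebraTower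
open Summit.ResolutionOfSingularities.ResolutionOfSingularities.Theorems.FRationalResolution.VertexChartMonoid
open Summit.ResolutionOfSingularities.ResolutionOfSingularities.Theorems.FRationalResolution.VertexChartBlowupCharts
open Summit.ResolutionOfSingularities.ResolutionOfSingularities.Theorems.FRationalResolution.VertexChartRegularity
open Summit.ResolutionOfSingularities.ResolutionOfSingularities.Theorems.FRationalResolution.VertexChartSmallParameter
open Summit.ResolutionOfSingularities.ResolutionOfSingularities.Theorems.FRationalResolution.ConeChain

namespace Summit.ResolutionOfSingularities.ResolutionOfSingularities.Theorems.FRationalResolution.ConeChainCharts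

universe u

variable {A : Type u} [CommRing A] {n : ℕ} {P : AddSubmonoid (Fin n → ℤ)}
  {φ : Multiplicative P →* A} {𝔭 : Ideal A} [𝔭.IsPrime] {C : Type u} [CommRing C] [Algebra A C]
  {Q : AddSubmonoid (Fin n → ℤ)} {χ : Multiplicative Q →* C} {L : Submodule ℤ (Fin n → ℤ)}
  {u e : Fin n → ℤ} {a d : ℕ}

/-! ### Monoid-level bookkeeping -/

omit [𝔭.IsPrime] in
/-- The tree's chart monoid along `S = {q : Q | q ∈ s}` at `h` is `⟨Q ∪ (s − h)⟩`.
[cite: Niziol2006, §4 (proof of Prop. 4.2)] -/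
theorem blowupChartMonoid_eq_closure {s : Set (Fin n → ℤ)} (hs : s ⊆ Q) {h : Fin n → ℤ} (hh : h ∈ Q) :
    blowupChartMonoid Q {q : Q | (q : Fin n → ℤ) ∈ s} ⟨h, hh⟩ =
      AddSubmonoid.closure ((Q : Set (Fin n → ℤ)) ∪ (fun q => q - h) '' s) := by
  unfold blowupChartMonoid
  congr 1
  ext z
  simp only [Set.mem_union, Set.mem_image, Set.mem_setOf_eq, SetLike.mem_coe]
  constructor
  · rintro (hz | ⟨q, hq, rfl⟩)
    · exact Or.inl hz
    · exact Or.inr ⟨q, hq, rfl⟩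
  · rintro (hz | ⟨q, hq, rfl⟩)
    · exact Or.inl hz
    · exact Or.inr ⟨⟨q, hs hq⟩, hq, rfl⟩

omit [𝔭.IsPrime] in
/-- `S = {q : Q | q ∈ s}` is finite when `s` is. [folklore] -/
theorem preimage_finite {s : Set (Fin n → ℤ)} (hs : s.Finite) :
    ({q : Q | (q : Fin n → ℤ) ∈ s} : Set Q).Finite :=
  hs.preimage Subtype.val_injective.injOn

/-- **(S) for cones**: `q₁ + q₂ ∈ L`, `q₁, q₂ ∈ Q` forces `q₁ ∈ L` (`d > 0`). [cite: Kato1994, (10.1)] -/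
theorem cone_face (hd : 0 < d)
    (hQ : ∀ w, w ∈ Q ↔ ∃ g ∈ L, ∃ m l : ℤ, 0 ≤ l ∧ (a : ℤ) * l ≤ (d : ℤ) * m ∧ w = g + m • u + l • e)
    (hind : ∀ g ∈ L, ∀ m l : ℤ, g + m • u + l • e = 0 → m = 0 ∧ l = 0) :
    ∀ q₁ ∈ Q, ∀ q₂ ∈ Q, q₁ + q₂ ∈ L → q₁ ∈ L := by
  intro q₁ hq₁ q₂ hq₂ h12
  obtain ⟨g₁, hg₁, m₁, l₁, hl₁, hml₁, rfl⟩ := (hQ q₁).1 hq₁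
  obtain ⟨g₂, hg₂, m₂, l₂, hl₂, hml₂, rfl⟩ := (hQ q₂).1 hq₂
  have hsum : g₁ + m₁ • u + l₁ • e + (g₂ + m₂ • u + l₂ • e) =
      (g₁ + g₂) + (m₁ + m₂) • u + (l₁ + l₂) • e := by module
  rw [hsum, mem_L_iff hind (L.add_mem hg₁ hg₂)] at h12
  rw [mem_L_iff hind hg₁]
  have hdpos : (0 : ℤ) < d := by exact_mod_cast hd
  have hm₁ : 0 ≤ m₁ := ConeChainClosure.nonneg_of_mul_nonneg_pos hdpos ((mul_nonneg (by positivity) hl₁).trans hml₁)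
  have hm₂ : 0 ≤ m₂ := ConeChainClosure.nonneg_of_mul_nonneg_pos hdpos ((mul_nonneg (by positivity) hl₂).trans hml₂)
  omega

omit [𝔭.IsPrime] in
/-- **A set generating `Q ∖ L` over `Q` generates the ideal of non-units**: `(χ(q) : q ∉ L) = (χ(s))`.
[cite: Kato1994, (10.1)] -/
theorem span_chi_eq_of_generates {R : Type*} [CommRing R] (χ : Multiplicative Q →* R) {s : Set (Fin n → ℤ)}
    (hsQ : s ⊆ Q) (hsL : ∀ h ∈ s, h ∉ L) (hgen : ∀ q ∈ Q, q ∉ L → ∃ h ∈ s, q - h ∈ Q) :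
    Ideal.span ((fun q : Q => χ (Multiplicative.ofAdd q)) '' {q : Q | (q : Fin n → ℤ) ∉ L}) =
      Ideal.span ((fun q : Q => χ (Multiplicative.ofAdd q)) '' {q : Q | (q : Fin n → ℤ) ∈ s}) := by
  refine le_antisymm (Ideal.span_le.2 ?_) (Ideal.span_mono (Set.image_mono fun q hq => hsL _ hq))
  rintro _ ⟨q, hq, rfl⟩
  obtain ⟨h, hh, hqh⟩ := hgen q q.2 hq
  have e1 : χ (Multiplicative.ofAdd q) =
      χ (Multiplicative.ofAdd ⟨h, hsQ hh⟩) * χ (Multiplicative.ofAdd ⟨(q : Fin n → ℤ) - h, hqh⟩) := by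
    rw [← map_mul, ← ofAdd_add]
    congr 1
    apply Multiplicative.toAdd.injective
    apply Subtype.ext
    change (q : Fin n → ℤ) = h + ((q : Fin n → ℤ) - h)
    abel
  change χ (Multiplicative.ofAdd q) ∈ _
  rw [e1]
  exact Ideal.mul_mem_right _ _ (Ideal.subset_span ⟨⟨h, hsQ hh⟩, hh, rfl⟩)

/-- **A vertex chart is a cone in normal form**: `L + {m v + l x : m ≥ 0, m + c l ≥ 0}` (`c ≥ 1`) is
`L + {m' x + l' (v − x) : l' ≥ 0, (c − 1) l' ≤ c m'}` — data `(x, v − x)`, `(d, a) = (c, c − 1)`. So the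
singular output of a round (a vertex chart with `2 ≤ c ≤ d − 2`) is again an input, with measure `c`.
[cite: Kato1994, (10.1)] -/
theorem cone_of_vertex {v x : Fin n → ℤ} {c : ℕ} (hc : 1 ≤ c)
    (hQ : ∀ w, w ∈ Q ↔ ∃ g ∈ L, ∃ m l : ℤ, 0 ≤ m ∧ 0 ≤ m + (c : ℤ) * l ∧ w = g + m • v + l • x)
    (hind : ∀ g ∈ L, ∀ m l : ℤ, g + m • v + l • x = 0 → m = 0 ∧ l = 0) :
    (∀ w, w ∈ Q ↔ ∃ g ∈ L, ∃ m l : ℤ, 0 ≤ l ∧ ((c - 1 : ℕ) : ℤ) * l ≤ (c : ℤ) * m ∧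
        w = g + m • x + l • (v - x)) ∧
      (∀ g ∈ L, ∀ m l : ℤ, g + m • x + l • (v - x) = 0 → m = 0 ∧ l = 0) ∧
      (∀ w : Fin n → ℤ, (∃ g ∈ L, ∃ m l : ℤ, w = g + m • v + l • x) →
        ∃ g ∈ L, ∃ m l : ℤ, w = g + m • x + l • (v - x)) := by
  have hc1 : ((c - 1 : ℕ) : ℤ) = (c : ℤ) - 1 := by omega
  refine ⟨fun w => ?_, fun g hg m l h => ?_, ?_⟩
  · rw [hQ w, hc1]
    constructor
    · rintro ⟨g, hg, m, l, hm, hml, rfl⟩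
      exact ⟨g, hg, m + l, m, hm, by nlinarith, by module⟩
    · rintro ⟨g, hg, m, l, hl, hml, rfl⟩
      exact ⟨g, hg, l, m - l, hl, by nlinarith, by module⟩
  · have := hind g hg l (m - l) (by rw [← h]; module)
    omega
  · rintro w ⟨g, hg, m, l, rfl⟩
    exact ⟨g, hg, m + l, m, by module⟩

/-! ### The charts of one round -/

/-- **All charts of the blow-up of the fixed point of a cone chart are vertex charts.** For a cone in
normal form `Q = L + {m u + l e : l ≥ 0, a l ≤ d m}` (`a < d`): a finite `s ⊆ Q ∖ L` generating `Q ∖ L`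
over `Q` such that for every `h ∈ s` the tree's chart monoid `LogChart.blowupChartMonoid Q S h`,
`S = {q : Q | q ∈ s}`, is `L + {m v + l x : m ≥ 0, m + c l ≥ 0}` with `(v, x)` independent modulo `L`,
spanning what `(u, e)` spans, and `c ≤ 1 ∨ c + 2 ≤ d`. [cite: Kato1994, (10.1)] [cite: KempfEtAl1973, Ch. I §2] -/
theorem round_charts (had : a < d)
    (hQ : ∀ w, w ∈ Q ↔ ∃ g ∈ L, ∃ m l : ℤ, 0 ≤ l ∧ (a : ℤ) * l ≤ (d : ℤ) * m ∧ w = g + m • u + l • e)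
    (hind : ∀ g ∈ L, ∀ m l : ℤ, g + m • u + l • e = 0 → m = 0 ∧ l = 0) :
    ∃ s : Set (Fin n → ℤ), s.Finite ∧ s ⊆ Q ∧ (∀ h ∈ s, h ∉ L) ∧
      (∀ q ∈ Q, q ∉ L → ∃ h ∈ s, q - h ∈ Q) ∧
      ∀ (h : Fin n → ℤ) (hhQ : h ∈ Q), h ∈ s → ∃ v x : Fin n → ℤ, ∃ c : ℕ, (c ≤ 1 ∨ c + 2 ≤ d) ∧
        (∀ g ∈ L, ∀ m l : ℤ, g + m • v + l • x = 0 → m = 0 ∧ l = 0) ∧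
        (∀ w : Fin n → ℤ, (∃ g ∈ L, ∃ m l : ℤ, w = g + m • u + l • e) →
          ∃ g ∈ L, ∃ m l : ℤ, w = g + m • v + l • x) ∧
        ∀ w, w ∈ blowupChartMonoid Q {q : Q | (q : Fin n → ℤ) ∈ s} ⟨h, hhQ⟩ ↔
          ∃ g ∈ L, ∃ m l : ℤ, 0 ≤ m ∧ 0 ≤ m + (c : ℤ) * l ∧ w = g + m • v + l • x := by
  obtain ⟨nb, hnb⟩ : ∃ nb : Fin n → ℤ, (a = 0 ∧ nb = e) ∨ (0 < a ∧ nb = u + e) := by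
    rcases Nat.eq_zero_or_pos a with h | h
    exacts [⟨e, Or.inl ⟨h, rfl⟩⟩, ⟨u + e, Or.inr ⟨h, rfl⟩⟩]
  obtain ⟨s, hsfin, -, -, hsQ, hsL, hgen, -, -, hchart⟩ := chain_exists (L := L) d a had Q u e nb hind hQ hnb
  refine ⟨s, hsfin, hsQ, hsL, hgen, fun h hhQ hh => ?_⟩
  obtain ⟨v, x, c, hcd, hindvx, hspanvx, hiff⟩ := hchart h hh
  refine ⟨v, x, c, hcd, hindvx, hspanvx, fun w => ?_⟩
  rw [blowupChartMonoid_eq_closure hsQ hhQ]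
  exact hiff w

/-! ### The centre of the round: the maximal ideal at the fixed prime -/

/-- **At the fixed prime the maximal ideal is `(χ(s))·C_𝔓`.** For a cone chart algebra over a point `𝔭`
of zero-dimensional stratum (`𝔪_{A_𝔭} ≤ I(𝔭, φ)A_𝔭`), at the prime `𝔓` over `𝔭` containing `χ(Q ∖ L)`,
and `s ⊆ Q ∖ L` generating `Q ∖ L` over `Q`: `𝔪_{C_𝔓} = (χ(h) : h ∈ s)·C_𝔓` — the point blow-up of the
fixed point is covered by the charts `C[(χ(s))/χ(h)]`, `h ∈ s`. [cite: Kato1994, Def. (2.1), (10.1)] -/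
theorem maximalIdeal_fixedPrime_eq_map_span (hd : 0 < d) (hPQ : P ≤ Q)
    (hχ : ∀ p : P, χ (Multiplicative.ofAdd ⟨(p : Fin n → ℤ), hPQ p.2⟩) =
      algebraMap A C (φ (Multiplicative.ofAdd p)))
    (hgen : Algebra.adjoin A (Set.range χ) = ⊤)
    (hQ : ∀ w, w ∈ Q ↔ ∃ g ∈ Submodule.span ℤ (faceMonoid P φ 𝔭 : Set (Fin n → ℤ)), ∃ m l : ℤ,
      0 ≤ l ∧ (a : ℤ) * l ≤ (d : ℤ) * m ∧ w = g + m • u + l • e)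
    (hind : ∀ g ∈ Submodule.span ℤ (faceMonoid P φ 𝔭 : Set (Fin n → ℤ)), ∀ m l : ℤ,
      g + m • u + l • e = 0 → m = 0 ∧ l = 0)
    {s : Set (Fin n → ℤ)} (hsQ : s ⊆ Q)
    (hsL : ∀ h ∈ s, h ∉ Submodule.span ℤ (faceMonoid P φ 𝔭 : Set (Fin n → ℤ)))
    (hsgen : ∀ q ∈ Q, q ∉ Submodule.span ℤ (faceMonoid P φ 𝔭 : Set (Fin n → ℤ)) → ∃ h ∈ s, q - h ∈ Q)
    {𝔓 : Ideal C} [𝔓.IsPrime] (h𝔓 : 𝔓.comap (algebraMap A C) = 𝔭)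
    (hq : ∀ q : Q, (q : Fin n → ℤ) ∉ Submodule.span ℤ (faceMonoid P φ 𝔭 : Set (Fin n → ℤ)) →
      χ (Multiplicative.ofAdd q) ∈ 𝔓)
    (h0 : maximalIdeal (Localization.AtPrime 𝔭) ≤
      (ideal P φ 𝔭).map (algebraMap A (Localization.AtPrime 𝔭))) :
    maximalIdeal (Localization.AtPrime 𝔓) =
      (Ideal.span ((fun q : Q => χ (Multiplicative.ofAdd q)) '' {q : Q | (q : Fin n → ℤ) ∈ s})).map
        (algebraMap C (Localization.AtPrime 𝔓)) := by
  have hset : {q : Q | χ (Multiplicative.ofAdd q) ∈ 𝔓} =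
      {q : Q | (q : Fin n → ℤ) ∉ Submodule.span ℤ (faceMonoid P φ 𝔭 : Set (Fin n → ℤ))} := by
    ext q
    simp only [Set.mem_setOf_eq]
    rw [← not_mem_iff_mem_span_of_comap_eq hPQ hχ h𝔓 hq q, not_not]
  rw [maximalIdeal_eq_map_ideal_of_fixedPrime hPQ hχ hgen (cone_face hd hQ hind) h𝔓 hq h0]
  unfold ideal
  rw [hset, span_chi_eq_of_generates χ hsQ hsL hsgen]

/-! ### Regularity on the charts of the round -/

variable [IsNoetherianRing A] {s : Set (Fin n → ℤ)} {h v x : Fin n → ℤ} {c : ℕ}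

/-- **Off the fixed point a chart of the round is regular.** On `C_h = C[(χ(s))/χ(h)]` with vertex data
`(v, x, c)` for its chart monoid: a prime over `𝔭` at which one of `χ_h(v)`, `χ_h(x)`, `χ_h(c v − x)` is
a unit is regular. [cite: Kato1994, (10.1), (10.3)] -/
theorem isRegularLocalRing_chart_of_not_mem (hP : P.FG)
    (hsat : ∀ (w : Fin n → ℤ) (k : ℕ), 0 < k → k • w ∈ P → w ∈ P)
    (hspanP : Submodule.span ℤ (P : Set (Fin n → ℤ)) = ⊤) (hPQ : P ≤ Q)
    (hχ : ∀ p : P, χ (Multiplicative.ofAdd ⟨(p : Fin n → ℤ), hPQ p.2⟩) =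
      algebraMap A C (φ (Multiplicative.ofAdd p)))
    (hgen : Algebra.adjoin A (Set.range χ) = ⊤)
    (hD : ∀ q ∈ Q, ∃ p ∈ P, q + p ∈ P)
    (hK : ∀ a : A, algebraMap A C a = 0 → ∃ p : P, φ (Multiplicative.ofAdd p) * a = 0)
    (hΩ : ∀ (K : Type u) [Field K] (g : A →+* K), (∀ p : P, g (φ (Multiplicative.ofAdd p)) ≠ 0) →
      ∃ ω : C →+* K, ω.comp (algebraMap A C) = g)
    (hreg : IsLogRegularAt P φ 𝔭) (hhQ : h ∈ Q)
    (hQh : ∀ w, w ∈ blowupChartMonoid Q {q : Q | (q : Fin n → ℤ) ∈ s} ⟨h, hhQ⟩ ↔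
      ∃ g ∈ Submodule.span ℤ (faceMonoid P φ 𝔭 : Set (Fin n → ℤ)), ∃ m l : ℤ,
        0 ≤ m ∧ 0 ≤ m + (c : ℤ) * l ∧ w = g + m • v + l • x)
    (hind : ∀ g ∈ Submodule.span ℤ (faceMonoid P φ 𝔭 : Set (Fin n → ℤ)), ∀ m l : ℤ,
      g + m • v + l • x = 0 → m = 0 ∧ l = 0)
    (hspan : ∀ w : Fin n → ℤ, ∃ g ∈ Submodule.span ℤ (faceMonoid P φ 𝔭 : Set (Fin n → ℤ)),
      ∃ m l : ℤ, w = g + m • v + l • x)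
    (𝔔 : Ideal (blowupAlgebra (Ideal.span ((fun q : Q => χ (Multiplicative.ofAdd q)) ''
        {q : Q | (q : Fin n → ℤ) ∈ s})) (χ (Multiplicative.ofAdd ⟨h, hhQ⟩)))) [𝔔.IsPrime]
    (h𝔔 : 𝔔.comap (algebraMap A _) = 𝔭)
    (hv' : v ∈ blowupChartMonoid Q {q : Q | (q : Fin n → ℤ) ∈ s} ⟨h, hhQ⟩)
    (hx' : x ∈ blowupChartMonoid Q {q : Q | (q : Fin n → ℤ) ∈ s} ⟨h, hhQ⟩)
    (hy' : (c : ℤ) • v - x ∈ blowupChartMonoid Q {q : Q | (q : Fin n → ℤ) ∈ s} ⟨h, hhQ⟩)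
    (hunit : blowupChart Q χ {q : Q | (q : Fin n → ℤ) ∈ s} ⟨h, hhQ⟩ (Multiplicative.ofAdd ⟨v, hv'⟩) ∉ 𝔔 ∨
      blowupChart Q χ {q : Q | (q : Fin n → ℤ) ∈ s} ⟨h, hhQ⟩ (Multiplicative.ofAdd ⟨x, hx'⟩) ∉ 𝔔 ∨
      blowupChart Q χ {q : Q | (q : Fin n → ℤ) ∈ s} ⟨h, hhQ⟩
        (Multiplicative.ofAdd ⟨(c : ℤ) • v - x, hy'⟩) ∉ 𝔔) :
    IsRegularLocalRing (Localization.AtPrime 𝔔) := by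
  obtain ⟨hgen₂, hD₂, -, hΩ₂⟩ := tower_pack hPQ hχ hgen hD hK hΩ {q : Q | (q : Fin n → ℤ) ∈ s} ⟨h, hhQ⟩
  have hχ₂ := tower_chi hPQ hχ (le_blowupChartMonoid Q {q : Q | (q : Fin n → ℤ) ∈ s} ⟨h, hhQ⟩)
    (blowupChart_of_mem Q χ {q : Q | (q : Fin n → ℤ) ∈ s} ⟨h, hhQ⟩)
  exact isRegularLocalRing_of_generator_not_mem hP hsat hspanP
    (hPQ.trans (le_blowupChartMonoid Q {q : Q | (q : Fin n → ℤ) ∈ s} ⟨h, hhQ⟩))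
    hχ₂ hgen₂ hΩ₂ hD₂ hQh hind hspan 𝔔 h𝔔 hreg hv' hx' hy' hunit

/-- **For parameter `c ≤ 1` a chart of the round is regular at every prime over `𝔭`** (end charts and
charts at chain elements with `b_h ≤ 3`). [cite: Kato1994, (10.1), (10.3)] -/
theorem isRegularLocalRing_chart_of_param_le_one (hc : c ≤ 1) (hP : P.FG)
    (hsat : ∀ (w : Fin n → ℤ) (k : ℕ), 0 < k → k • w ∈ P → w ∈ P)
    (hspanP : Submodule.span ℤ (P : Set (Fin n → ℤ)) = ⊤) (hPQ : P ≤ Q)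
    (hχ : ∀ p : P, χ (Multiplicative.ofAdd ⟨(p : Fin n → ℤ), hPQ p.2⟩) =
      algebraMap A C (φ (Multiplicative.ofAdd p)))
    (hgen : Algebra.adjoin A (Set.range χ) = ⊤)
    (hD : ∀ q ∈ Q, ∃ p ∈ P, q + p ∈ P)
    (hK : ∀ a : A, algebraMap A C a = 0 → ∃ p : P, φ (Multiplicative.ofAdd p) * a = 0)
    (hΩ : ∀ (K : Type u) [Field K] (g : A →+* K), (∀ p : P, g (φ (Multiplicative.ofAdd p)) ≠ 0) →
      ∃ ω : C →+* K, ω.comp (algebraMap A C) = g)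
    (hreg : IsLogRegularAt P φ 𝔭) (hhQ : h ∈ Q)
    (hQh : ∀ w, w ∈ blowupChartMonoid Q {q : Q | (q : Fin n → ℤ) ∈ s} ⟨h, hhQ⟩ ↔
      ∃ g ∈ Submodule.span ℤ (faceMonoid P φ 𝔭 : Set (Fin n → ℤ)), ∃ m l : ℤ,
        0 ≤ m ∧ 0 ≤ m + (c : ℤ) * l ∧ w = g + m • v + l • x)
    (hind : ∀ g ∈ Submodule.span ℤ (faceMonoid P φ 𝔭 : Set (Fin n → ℤ)), ∀ m l : ℤ,
      g + m • v + l • x = 0 → m = 0 ∧ l = 0)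
    (hspan : ∀ w : Fin n → ℤ, ∃ g ∈ Submodule.span ℤ (faceMonoid P φ 𝔭 : Set (Fin n → ℤ)),
      ∃ m l : ℤ, w = g + m • v + l • x)
    (𝔔 : Ideal (blowupAlgebra (Ideal.span ((fun q : Q => χ (Multiplicative.ofAdd q)) ''
        {q : Q | (q : Fin n → ℤ) ∈ s})) (χ (Multiplicative.ofAdd ⟨h, hhQ⟩)))) [𝔔.IsPrime]
    (h𝔔 : 𝔔.comap (algebraMap A _) = 𝔭) :
    IsRegularLocalRing (Localization.AtPrime 𝔔) := by
  obtain ⟨hgen₂, -, -, hΩ₂⟩ := tower_pack hPQ hχ hgen hD hK hΩ {q : Q | (q : Fin n → ℤ) ∈ s} ⟨h, hhQ⟩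
  have hχ₂ := tower_chi hPQ hχ (le_blowupChartMonoid Q {q : Q | (q : Fin n → ℤ) ∈ s} ⟨h, hhQ⟩)
    (blowupChart_of_mem Q χ {q : Q | (q : Fin n → ℤ) ∈ s} ⟨h, hhQ⟩)
  have hreg' : IsLogRegularAt P φ (𝔔.comap (algebraMap A _)) := by
    have key : ∀ (𝔮 : Ideal A) [𝔮.IsPrime], 𝔮 = 𝔭 → IsLogRegularAt P φ 𝔮 := by
      intro 𝔮 _ h'; subst h'; exact hreg
    exact key _ h𝔔
  exact isRegularLocalRing_of_param_le_one hc hP hsat hspanP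
    (hPQ.trans (le_blowupChartMonoid Q {q : Q | (q : Fin n → ℤ) ∈ s} ⟨h, hhQ⟩)) hχ₂ hgen₂ hΩ₂ hQh hind hspan 𝔔 hreg'

/-- **For parameter `c ≥ 2` the fixed prime of a chart of the round is singular** (over a surface point of
zero-dimensional stratum): on `C_h` the prime over `𝔭` containing all `χ_h(q)`, `q ∉ L`, is not regular.
[cite: Kato1994, (6.1), (10.1)] -/
theorem not_isRegularLocalRing_chart_fixedPrime [IsNoetherianRing C] (hc : 2 ≤ c) (hs : s.Finite)
    (hP : P.FG) (hsat : ∀ (w : Fin n → ℤ) (k : ℕ), 0 < k → k • w ∈ P → w ∈ P)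
    (hreg : IsLogRegularAt P φ 𝔭) (hPQ : P ≤ Q)
    (hχ : ∀ p : P, χ (Multiplicative.ofAdd ⟨(p : Fin n → ℤ), hPQ p.2⟩) =
      algebraMap A C (φ (Multiplicative.ofAdd p)))
    (hgen : Algebra.adjoin A (Set.range χ) = ⊤)
    (hD : ∀ q ∈ Q, ∃ p ∈ P, q + p ∈ P)
    (hK : ∀ a : A, algebraMap A C a = 0 → ∃ p : P, φ (Multiplicative.ofAdd p) * a = 0)
    (hΩ : ∀ (K : Type u) [Field K] (g : A →+* K), (∀ p : P, g (φ (Multiplicative.ofAdd p)) ≠ 0) →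
      ∃ ω : C →+* K, ω.comp (algebraMap A C) = g)
    (hQfg : Q.FG) (hhQ : h ∈ Q)
    (hQh : ∀ w, w ∈ blowupChartMonoid Q {q : Q | (q : Fin n → ℤ) ∈ s} ⟨h, hhQ⟩ ↔
      ∃ g ∈ Submodule.span ℤ (faceMonoid P φ 𝔭 : Set (Fin n → ℤ)), ∃ m l : ℤ,
        0 ≤ m ∧ 0 ≤ m + (c : ℤ) * l ∧ w = g + m • v + l • x)
    (hind : ∀ g ∈ Submodule.span ℤ (faceMonoid P φ 𝔭 : Set (Fin n → ℤ)), ∀ m l : ℤ,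
      g + m • v + l • x = 0 → m = 0 ∧ l = 0)
    (hspan : ∀ w : Fin n → ℤ, ∃ g ∈ Submodule.span ℤ (faceMonoid P φ 𝔭 : Set (Fin n → ℤ)),
      ∃ m l : ℤ, w = g + m • v + l • x)
    (h0 : maximalIdeal (Localization.AtPrime 𝔭) ≤
      (ideal P φ 𝔭).map (algebraMap A (Localization.AtPrime 𝔭)))
    (hdimA : ringKrullDim (Localization.AtPrime 𝔭) ≤ (2 : ℕ))
    {𝔔 : Ideal (blowupAlgebra (Ideal.span ((fun q : Q => χ (Multiplicative.ofAdd q)) ''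
        {q : Q | (q : Fin n → ℤ) ∈ s})) (χ (Multiplicative.ofAdd ⟨h, hhQ⟩)))} [𝔔.IsPrime]
    (h𝔔 : 𝔔.comap (algebraMap A _) = 𝔭)
    (hq : ∀ q : blowupChartMonoid Q {q : Q | (q : Fin n → ℤ) ∈ s} ⟨h, hhQ⟩,
      (q : Fin n → ℤ) ∉ Submodule.span ℤ (faceMonoid P φ 𝔭 : Set (Fin n → ℤ)) →
        blowupChart Q χ {q : Q | (q : Fin n → ℤ) ∈ s} ⟨h, hhQ⟩ (Multiplicative.ofAdd q) ∈ 𝔔) :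
    ¬ IsRegularLocalRing (Localization.AtPrime 𝔔) := by
  haveI : IsNoetherianRing (blowupAlgebra (Ideal.span ((fun q : Q => χ (Multiplicative.ofAdd q)) ''
      {q : Q | (q : Fin n → ℤ) ∈ s})) (χ (Multiplicative.ofAdd ⟨h, hhQ⟩))) :=
    isNoetherianRing_blowupAlgebra_of_isNoetherianRing _ _
  obtain ⟨hgen₂, hD₂, hK₂, -⟩ := tower_pack hPQ hχ hgen hD hK hΩ {q : Q | (q : Fin n → ℤ) ∈ s} ⟨h, hhQ⟩
  have hχ₂ := tower_chi hPQ hχ (le_blowupChartMonoid Q {q : Q | (q : Fin n → ℤ) ∈ s} ⟨h, hhQ⟩)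
    (blowupChart_of_mem Q χ {q : Q | (q : Fin n → ℤ) ∈ s} ⟨h, hhQ⟩)
  have hfg₂ : (blowupChartMonoid Q {q : Q | (q : Fin n → ℤ) ∈ s} ⟨h, hhQ⟩).FG :=
    blowupChartMonoid_fg hQfg (preimage_finite hs) ⟨h, hhQ⟩
  exact not_isRegularLocalRing_fixedPrime_of_two_le hc hP hsat hreg
    (hPQ.trans (le_blowupChartMonoid Q {q : Q | (q : Fin n → ℤ) ∈ s} ⟨h, hhQ⟩)) hχ₂ hgen₂ hD₂ hK₂ hfg₂
    hQh hind hspan h𝔔 hq h0 hdimA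

end Summit.ResolutionOfSingularities.ResolutionOfSingularities.Theorems.FRationalResolution.ConeChainCharts

end
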